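import Summits.ABC.IUTFork.Repair.RHSigmaMassMu
import HarnessLib

/-!
# R-H ROUND 3, SCREEN RULE S1 IN KERNEL: the mass a PARTIAL-CREDIT profile `ω` can keep — an `O(j)` credit above the slice keeps at most
# `S(J) + a·T(l⋇) + b·l⋇` of a place's `S(l⋇)` demand («cubic → linear, never → 1»), a `θ·j²` credit keeps `S(J) + θ·(S(l⋇) − S(J))`

abc-iut cell, rung LADDER-ABC:A2.RESCUE.H; R-H seat abc-iut-rh2-w-1 (GEN 2; Q1′ WEIGHTS typer, kernel side). rh-lead g2's `plan/rescue/R-H/ROUND3/START-HERE.md`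
v1.1 SCREEN RULE S1 (from the signed (C-ii) law B24, abc-iut-rh2-tab-2 / rh3-ref-1): «write the candidate's per-cell CREDIT `c(w, j)` for `j > j₀(w)` and
report its GROWTH IN `j`: (a) credit `O(1)` or `O(j)` ⟹ pre-screened OUT as rescue (best reachable `Λ ≈ 1/(1.5 f)`); (b) credit `~ θ·j²` ⟹ exponent
`≈ 1/(share of j²-weight kept)`; (c) credit `≥ m_q·j² − O(j)` ⟹ that IS the licence (door N12)». This PROOF-ONLY file (0 definitions, 0 `Prop` facts) types
the MASS CONSEQUENCE of a credit profile — pure label arithmetic plus the bed dictionary of `Repair/RHSigmaMassMu.lean` (p482743) — so that the rh4 testers'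
S1 numbers are instances of a theorem. The WEIGHT `ω : cells → ℝ`, `ω ≤ 1`, is a candidate's CLAIMED kept fraction of a cell's trivial cost (abc-iut-rh2-q2-eq's
partial-credit door `RHSigmaCellCredit` / weighted door p480491 carry `ω` to the Corollary; the quantity bounded here, the ω-KEPT MASS
`K(ω) := PN(i ↦ Σᶠ_{v_ℚ} ω(i,v_ℚ)·cost(i,v_ℚ))`, is `M − weightedTrivialMass P ω` by their `weightedTrivialMass_add_compl`); nothing of theirs is restated.
* §0 LABEL ARITHMETIC: `Σ_{j ≤ n} (a·j + b) = a·T(n) + b·n`, `T(n) = n(n+1)/2` (`sum_fin_linear`); the HARMONIC profile of B24, `ω_j = min(1, J/j)`, has credit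
  `ω_j·(j²−1) ≤ J·j` (`harmonicCredit_mul_sqSubOne_le`) — an `O(j)` credit with `a = J`, `b = 0`; the fraction identity
  `(S(J) + J·T(n))/S(n) = S(J)/S(n) + 3J(n+1)/((n−1)(2n+5))` (`harmonicKeptFrac_eq`; `→ f³ + (3/2)·f`, `f = J/n`).
* §1 PLACE LEVEL (one packet, `n = l⋇` labels, place weight `h ≥ 0`, slice `J ≤ n`, any `ω ≤ 1`): (S1-a) `ω_j(j²−1) ≤ a·j + b` above `J` (`a, b ≥ 0`) ⟹
  `Σ_j ω_j(j²−1)h ≤ (S(J) + a·T(n) + b·n)·h` (`placeSum_credit_le_of_linear`); (S1-b) `ω_j(j²−1) ≤ θ(j²−1)` above `J` ⟹ `Σ_j ω_j(j²−1)h ≤ (S(J) + θ(S(n) − S(J)))·h`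
  (`placeSum_credit_le_of_quadratic`).
* §2 AT THE BED `settingPrVolSharp X` (any DH pilot datum, realising ideles; `cost(i,v_ℚ) = ((i+1)²−1)·h(v_ℚ)`, p478601 + p482743): the ω-KEPT MASS obeys
  **`K(ω) ≤ (1/l⋇)·Σᶠ_{v_ℚ} (S(J(v_ℚ)) + a(v_ℚ)·T(l⋇) + b(v_ℚ)·l⋇)·h(v_ℚ)`** under a per-packet `O(j)` credit law (`keptMass_settingPrVolSharp_le_of_linearCredit`),
  **`K(ω) ≤ (1/l⋇)·Σᶠ_{v_ℚ} (S(J) + θ·(S(l⋇) − S(J)))·h`** under a `θ·j²` law (`keptMass_settingPrVolSharp_le_of_quadraticCredit`), and for UNIFORM `J, a, b`: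
  **`K(ω) ≤ ((S(J) + a·T(l⋇) + b·l⋇)/S(l⋇))·M`** (`keptMass_settingPrVolSharp_le_frac_mul_totalTrivialMass`) — READING (S1-a, B24 in kernel): a harmonic /
  any `O(j)` credit turns the licence-only kept share `S(J)/S(l⋇) ≈ f³` into at most `f³ + (3/2)(a/J)·f·(1+o(1))` — LINEAR in `f`, `< 1` unless `f → 1`;
  recovering the `j²`-mass needs credit growing like `j²` at the top labels (S1-b with `θ → 1`, which at `θ = 1` is the licence itself, door N12).
HONEST FRAMING: arithmetic about OUR typed weights; `ω` is a HYPOTHESIS SHAPE (a candidate's claimed credit), never asserted for any object; nothing here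
asserts that abc is proved or refuted, or that [IUTchIII] Cor. 3.12 holds or fails at any datum, or takes a side on any author; typed ≠ proved; computed ≠ proved.
[claim: Mochizuki2012, status: disputed] for every IUT locution. [cite: Mochizuki2012, IUTchIII Cor. 3.12 p. 173–174, Prop. 3.9 (i)–(iii) p. 116–117;
IUTchIV Thm. 1.10 Step (v) p. 27–29] [cite: DupuyHilado2025, §3.3, Thm. 3.10.1]
-/

noncomputable section

open Set Function NumberField IsDedekindDomain

namespace Summit.ABC.IUTFork.Repair.RH.CellWeights

open Summit.ABC.IUTFork.Thm311 Summit.ABC.IUTFork.Thm311.Real Summit.ABC.IUTFork.Cor312 Summit.ABC.IUTFork.Cor312.Setting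
  Summit.ABC.IUTFork.Cor312Vol Summit.ABC.IUTFork.Cor312Prov Literature.IUT.LogThetaLattice Literature.IUT.LogVolume
  Literature.IUT.HodgeTheaters Literature.IUT.LogVolume.ThetaData
  Summit.ABC.IUTFork.Repair.RH.SigmaLicence Summit.ABC.IUTFork.Repair.RH.SigmaStrataEq Summit.ABC.IUTFork.Repair.RH.SigmaMass

/-! ## §0. Label arithmetic: linear sums, the harmonic profile, the kept-fraction identity -/

section LabelArithmetic

/-- `Σ_{i<n} (a·(i+1) + b) = a·n(n+1)/2 + b·n` (the price side of an `O(j)` credit summed over the labels `j = i+1 ≤ n`). [folklore] -/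
theorem sum_range_linear (n : ℕ) (a b : ℝ) :
    ∑ i ∈ Finset.range n, (a * ((i : ℝ) + 1) + b) = a * ((n : ℝ) * (n + 1) / 2) + b * n := by
  induction n with
  | zero => simp
  | succ n ih =>
    rw [Finset.sum_range_succ, ih]
    push_cast
    ring

/-- The same over `Fin n` (the label index type of the typed Corollary). [folklore] -/
theorem sum_fin_linear (n : ℕ) (a b : ℝ) :
    ∑ i : Fin n, (a * (((i : ℕ) : ℝ) + 1) + b) = a * ((n : ℝ) * (n + 1) / 2) + b * n := by
  rw [Fin.sum_univ_eq_sum_range (fun i : ℕ => a * ((i : ℝ) + 1) + b) n, sum_range_linear]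

/-- **The HARMONIC credit of B24 is an `O(j)` credit**: `min(1, J/j)·(j² − 1) ≤ J·j` for every label `j = i+1` (abc-iut-rh2-tab-2's signed (C-ii) law: above
the slice boundary the exact cell's remaining relative credit is `c_j = j⋆/j`; here with `a = J`, `b = 0` in the notation of `placeSum_credit_le_of_linear`).
[folklore] -/
theorem harmonicCredit_mul_sqSubOne_le (J i : ℕ) :
    min 1 ((J : ℝ) / ((i : ℝ) + 1)) * (((i : ℝ) + 1) ^ 2 - 1) ≤ (J : ℝ) * ((i : ℝ) + 1) := by
  have hi : (0 : ℝ) < (i : ℝ) + 1 := by positivity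
  have hJ : (0 : ℝ) ≤ J := Nat.cast_nonneg J
  by_cases hc : (J : ℝ) / ((i : ℝ) + 1) ≤ 1
  · rw [min_eq_right hc, div_mul_eq_mul_div, div_le_iff₀ hi]
    nlinarith
  · rw [not_le] at hc
    rw [min_eq_left hc.le, one_mul]
    rw [lt_div_iff₀ hi, one_mul] at hc
    nlinarith [mul_le_mul_of_nonneg_left hc.le hi.le]

/-- The harmonic credit never exceeds the licence (`ω ≤ 1`). [folklore] -/
theorem harmonicCredit_le_one (J i : ℕ) : min 1 ((J : ℝ) / ((i : ℝ) + 1)) ≤ 1 :=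
  min_le_left _ _

/-- **THE KEPT-FRACTION IDENTITY for an `O(j)` credit with `a = J`, `b = 0`**: `(S(J) + J·T(n))/S(n) = S(J)/S(n) + 3J(n+1)/((n−1)(2n+5))` for `n ≥ 2`,
`S(k) = k(k−1)(2k+5)/6`, `T(n) = n(n+1)/2` — READING: with `f := J/n`, the licence-only share `S(J)/S(n) ≈ f³` (p476759 / p482743 sandwich) plus a term
`→ (3/2)·f`: «cubic → linear, never → 1 unless `f → 1`» (B24's `Λ_pc ≈ 1/(1.5 f)`). [folklore] -/
theorem harmonicKeptFrac_eq {n : ℕ} (hn : 2 ≤ n) (J : ℝ) :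
    (J * (J - 1) * (2 * J + 5) / 6 + J * ((n : ℝ) * (n + 1) / 2)) / ((n : ℝ) * (n - 1) * (2 * n + 5) / 6) =
      (J * (J - 1) * (2 * J + 5) / 6) / ((n : ℝ) * (n - 1) * (2 * n + 5) / 6) + 3 * J * ((n : ℝ) + 1) / (((n : ℝ) - 1) * (2 * n + 5)) := by
  have h2 : (2 : ℝ) ≤ n := by exact_mod_cast hn
  have hn0 : (n : ℝ) ≠ 0 := by positivity
  have hn1 : (n : ℝ) - 1 ≠ 0 := by
    have : (0 : ℝ) < (n : ℝ) - 1 := by linarith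
    exact this.ne'
  have hn5 : (2 * (n : ℝ) + 5) ≠ 0 := by positivity
  rw [add_div]
  congr 1
  field_simp
  ring

end LabelArithmetic

/-! ## §1. One packet: what a credit profile `ω ≤ 1` keeps of the place demand `S(n)·h` -/

section Place

/-- **(S1-a) AN `O(j)` CREDIT KEEPS AT MOST `S(J) + a·T(n) + b·n` OF THE PLACE'S `S(n)` DEMAND.** One packet with `n` labels, place weight `h ≥ 0`, slice
boundary `J ≤ n`; a profile `ω ≤ 1` (licence strength at most) whose credit ABOVE the slice is at most linear in the label in demand units,
`ω_i·((i+1)² − 1) ≤ a·(i+1) + b` for `i+1 > J` (`a, b ≥ 0`), keeps `Σ_i ω_i·((i+1)²−1)·h ≤ (S(J) + a·n(n+1)/2 + b·n)·h` (below the slice the licence bound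
`ω ≤ 1` gives `S(J)`, p476759 `sum_fin_sqSubOne_initialSegment`; above it the linear law, summed over all labels). [folklore] -/
theorem placeSum_credit_le_of_linear {n J : ℕ} (hJ : J ≤ n) (ω : Fin n → ℝ) (hω1 : ∀ i, ω i ≤ 1) {a b h : ℝ}
    (ha : 0 ≤ a) (hb : 0 ≤ b) (hh : 0 ≤ h)
    (hlin : ∀ i : Fin n, J < (i : ℕ) + 1 → ω i * ((((i : ℕ) : ℝ) + 1) ^ 2 - 1) ≤ a * (((i : ℕ) : ℝ) + 1) + b) :
    ∑ i : Fin n, ω i * (((((i : ℕ) : ℝ) + 1) ^ 2 - 1) * h) ≤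
      ((J : ℝ) * (J - 1) * (2 * J + 5) / 6 + a * ((n : ℝ) * (n + 1) / 2) + b * n) * h := by
  have hterm : ∀ i : Fin n, ω i * (((((i : ℕ) : ℝ) + 1) ^ 2 - 1) * h) ≤
      ((if (i : ℕ) + 1 ≤ J then (((i : ℕ) : ℝ) + 1) ^ 2 - 1 else 0) + (a * (((i : ℕ) : ℝ) + 1) + b)) * h := by
    intro i
    have hi0 : (0 : ℝ) ≤ (((i : ℕ) : ℝ) + 1) ^ 2 - 1 := by nlinarith [(Nat.cast_nonneg (i : ℕ) : (0 : ℝ) ≤ (i : ℕ))]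
    have hlin0 : 0 ≤ a * (((i : ℕ) : ℝ) + 1) + b := by positivity
    rw [← mul_assoc]
    refine mul_le_mul_of_nonneg_right ?_ hh
    by_cases hiJ : (i : ℕ) + 1 ≤ J
    · rw [if_pos hiJ]
      nlinarith [mul_nonneg (sub_nonneg.2 (hω1 i)) hi0]
    · rw [if_neg hiJ, zero_add]
      exact hlin i (by omega)
  refine (Finset.sum_le_sum fun i _ => hterm i).trans (le_of_eq ?_)
  rw [← Finset.sum_mul, Finset.sum_add_distrib, sum_fin_sqSubOne_initialSegment hJ, sum_fin_linear]
  ring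

/-- **(S1-b) A `θ·j²` CREDIT KEEPS AT MOST `S(J) + θ·(S(n) − S(J))`.** Same packet; a profile `ω ≤ 1` whose credit above the slice is at most the fraction `θ` of
the demand, `ω_i·((i+1)²−1) ≤ θ·((i+1)²−1)` for `i+1 > J`, keeps `Σ_i ω_i·((i+1)²−1)·h ≤ (S(J) + θ·(S(n) − S(J)))·h` — READING: the exponent is then
`≈ 1/(f³ + θ(1 − f³))`; `θ = 1` above the slice is the licence itself (door N12). [folklore] -/
theorem placeSum_credit_le_of_quadratic {n J : ℕ} (hJ : J ≤ n) (ω : Fin n → ℝ) (hω1 : ∀ i, ω i ≤ 1) {θ h : ℝ} (hh : 0 ≤ h)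
    (hquad : ∀ i : Fin n, J < (i : ℕ) + 1 → ω i * ((((i : ℕ) : ℝ) + 1) ^ 2 - 1) ≤ θ * ((((i : ℕ) : ℝ) + 1) ^ 2 - 1)) :
    ∑ i : Fin n, ω i * (((((i : ℕ) : ℝ) + 1) ^ 2 - 1) * h) ≤
      ((J : ℝ) * (J - 1) * (2 * J + 5) / 6 +
        θ * ((n : ℝ) * (n - 1) * (2 * n + 5) / 6 - (J : ℝ) * (J - 1) * (2 * J + 5) / 6)) * h := by
  have hterm : ∀ i : Fin n, ω i * (((((i : ℕ) : ℝ) + 1) ^ 2 - 1) * h) ≤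
      (θ * ((((i : ℕ) : ℝ) + 1) ^ 2 - 1) + (1 - θ) * (if (i : ℕ) + 1 ≤ J then (((i : ℕ) : ℝ) + 1) ^ 2 - 1 else 0)) * h := by
    intro i
    have hi0 : (0 : ℝ) ≤ (((i : ℕ) : ℝ) + 1) ^ 2 - 1 := by nlinarith [(Nat.cast_nonneg (i : ℕ) : (0 : ℝ) ≤ (i : ℕ))]
    rw [← mul_assoc]
    refine mul_le_mul_of_nonneg_right ?_ hh
    by_cases hiJ : (i : ℕ) + 1 ≤ J
    · rw [if_pos hiJ]
      nlinarith [mul_nonneg (sub_nonneg.2 (hω1 i)) hi0]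
    · rw [if_neg hiJ, mul_zero, add_zero]
      exact hquad i (by omega)
  refine (Finset.sum_le_sum fun i _ => hterm i).trans (le_of_eq ?_)
  rw [← Finset.sum_mul, Finset.sum_add_distrib, ← Finset.mul_sum, ← Finset.mul_sum, sum_fin_sqSubOne_initialSegment hJ, sum_fin_sqSubOne]
  ring

end Place

/-! ## §2. At the bed `settingPrVolSharp X`: the ω-kept mass under an `O(j)` / `θ·j²` credit law, and the uniform fraction form -/

section Bed

variable {F : Type} [Field F] [NumberField F] (X : PilotData F) {logv : PadicLogs F} (hlog : LogvAnalytic logv)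
  (M : Type) [Field M] [NumberField M]
  (archPk : ∀ (j : (thetaIndex X).Label) (vQ : (thetaIndex X).VQ), Set ((logShellsDH X logv).Packet j vQ))
  (archSub : ∀ (j : (thetaIndex X).Label) (v : (thetaIndex X).V),
    Set ((logShellsDH X logv).Packet j ((thetaIndex X).over v)))
  (Ψ : ℤ → ∀ v : (thetaIndex X).V, v ∈ (thetaIndex X).Vbad → Set ((logShellsDH X logv).StarPacket v))
  (act : ℤ → ∀ v : (thetaIndex X).V, v ∈ (thetaIndex X).Vbad →
    (logShellsDH X logv).StarPacket v → Module.End ℚ ((logShellsDH X logv).StarPacket v))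
  (Mmod : ℤ → ∀ j : (thetaIndex X).LabelStar, Set ((logShellsDH X logv).GlobalPacket j.1))
  (region : ℤ → ∀ j : (thetaIndex X).LabelStar, FinDivisor M → ∀ vQ : (thetaIndex X).VQ,
    Set ((logShellsDH X logv).Packet j.1 vQ))
  (n : ℤ) {HT : Type} {LogLink : HT → HT → Type} {IsFull : ∀ {s t : HT}, LogLink s t → Prop}
  (lat : LGPGaussianLogThetaLattice LogLink IsFull)
  {Frd : Type} {IsoF : Frd → Frd → Type} {Ob : Frd → Type} {realify : Frd → Frd} {Strip : Type}
  {IsoS : Strip → Strip → Type} {Mv : ∀ v : (thetaIndex X).V, v ∈ (thetaIndex X).Vbad → Type}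
  [∀ v h, Monoid (Mv v h)]
  (sig : GlobalLGPFrobenioidSignature (thetaIndex X).lstar (thetaIndex X).V (· ∈ (thetaIndex X).Vbad)
    Frd IsoF Ob realify Strip IsoS Mv)
  (split : SplittingMonoids Mv) {ObΔ : Type} {N : ∀ v : (thetaIndex X).V, v ∈ (thetaIndex X).Vbad → Type}
  [∀ v h, Monoid (N v h)] (qData : QPilotData ObΔ N)
  (tq : ∀ (pp : Nat.Primes) (x : (thetaIndex X).Fibre (.inr pp)), haveI : Fact (pp : ℕ).Prime := ⟨pp.2⟩; kOf X pp.1 x)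
  (t : ∀ (pp : Nat.Primes) (_ : Fin X.lstar) (x : (thetaIndex X).Fibre (.inr pp)),
    haveI : Fact (pp : ℕ).Prime := ⟨pp.2⟩; kOf X pp.1 x)
  (htq0 : ∀ pp x, tq pp x ≠ 0)
  (htq1 : ∀ (pp : Nat.Primes) (x : (thetaIndex X).Fibre (.inr pp)),
    haveI : Fact (pp : ℕ).Prime := ⟨pp.2⟩; placeOf X pp.1 x ∉ X.S → ‖tq pp x‖ = 1)
  (ht0 : ∀ pp i x, t pp i x ≠ 0)
  (ht : ∀ (pp : Nat.Primes) (i : Fin X.lstar) (x : (thetaIndex X).Fibre (.inr pp)),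
    haveI : Fact (pp : ℕ).Prime := ⟨pp.2⟩
    Real.log ‖t pp i x‖ = -(X.thetaPilot i (placeOf X pp.1 x)) * logNorm F (placeOf X pp.1 x) / localDegree F (placeOf X pp.1 x))
  (htq : ∀ (pp : Nat.Primes) (x : (thetaIndex X).Fibre (.inr pp)),
    haveI : Fact (pp : ℕ).Prime := ⟨pp.2⟩
    Real.log ‖tq pp x‖ = -(X.qPilot (placeOf X pp.1 x)) * logNorm F (placeOf X pp.1 x) / localDegree F (placeOf X pp.1 x))

include hlog M archPk archSub Ψ act Mmod region n lat sig split qData tq t htq0 htq1 htq in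
/-- The explicit place weight `h` is finitely supported over `v_ℚ` (it is `−qLocal_{1,v_ℚ}`; [IUTchIII] Prop. 3.9 (iii): `Setting.qSupport_finite`).
[claim: Mochizuki2012, status: disputed] -/
theorem placeWeight_support_finite :
    (Function.support fun vQ : (thetaIndex X).VQ => Sum.elim (fun _ : Unit => (0 : ℝ))
      (fun pp : Nat.Primes => (∑ v ∈ placesOver F pp, X.qPilot v * logNorm F v) / Module.finrank ℚ F) vQ).Finite := by
  have hl0 : 0 < (thetaIndex X).lstar := lt_of_lt_of_le (by norm_num) (thetaIndex X).two_le_lstar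
  refine ((settingPrVolSharp X hlog M archPk archSub Ψ act Mmod region n lat sig split qData tq t htq0 htq1).qSupport_finite
    (labelSucc ⟨0, hl0⟩)).subset (Function.support_subset_iff'.2 fun vQ hvQ => ?_)
  have h0 : (settingPrVolSharp X hlog M archPk archSub Ψ act Mmod region n lat sig split qData tq t htq0 htq1).qLocal
      (labelSucc ⟨0, hl0⟩) vQ = 0 := Function.notMem_support.1 hvQ
  rw [← negQLocal_settingPrVolSharp_eq_placeWeight X hlog M archPk archSub Ψ act Mmod region n lat sig split qData tq t htq0 htq1 htq ⟨0, hl0⟩ vQ,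
    h0, neg_zero]

include ht0 ht htq in
/-- At the bed the trivial cost of the cell `(i, v_ℚ)` is `((i+1)² − 1)·h(v_ℚ)` with the explicit place weight (p478601
`cellTrivialCost_settingPrVolSharp_eq_pilotGapWeight` ∘ p482743 `negQLocal_settingPrVolSharp_eq_placeWeight`). [claim: Mochizuki2012, status: disputed] -/
theorem cellTrivialCost_settingPrVolSharp_eq_sqSubOne_mul_placeWeight (i : Fin (thetaIndex X).lstar) (vQ : (thetaIndex X).VQ) :
    cellTrivialCost (settingPrVolSharp X hlog M archPk archSub Ψ act Mmod region n lat sig split qData tq t htq0 htq1) (i, vQ) =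
      ((((i : ℕ) : ℝ) + 1) ^ 2 - 1) * Sum.elim (fun _ : Unit => (0 : ℝ))
        (fun pp : Nat.Primes => (∑ v ∈ placesOver F pp, X.qPilot v * logNorm F v) / Module.finrank ℚ F) vQ := by
  have h := congrFun (cellTrivialCost_settingPrVolSharp_eq_pilotGapWeight X hlog M archPk archSub Ψ act Mmod region n lat sig split qData tq t htq0 htq1
    ht0 ht htq) (i, vQ)
  rw [h]
  dsimp only
  rw [negQLocal_settingPrVolSharp_eq_placeWeight X hlog M archPk archSub Ψ act Mmod region n lat sig split qData tq t htq0 htq1 htq i vQ]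

include ht0 ht htq in
/-- **(S1-a) AT THE BED: an `O(j)` credit keeps `K(ω) ≤ (1/l⋇)·Σᶠ_{v_ℚ} (S(J(v_ℚ)) + a(v_ℚ)·T(l⋇) + b(v_ℚ)·l⋇)·h(v_ℚ)`.** For ANY weight `ω ≤ 1` on the cells
(a candidate's claimed kept fraction of each cell's trivial cost) whose credit above the packet's slice `J(v_ℚ) ≤ l⋇` is at most linear in the label,
`ω(i,v_ℚ)·((i+1)²−1) ≤ a(v_ℚ)·(i+1) + b(v_ℚ)` for `i+1 > J(v_ℚ)` (`a, b ≥ 0`), the ω-KEPT MASS `PN(i ↦ Σᶠ_{v_ℚ} ω(i,v_ℚ)·cost(i,v_ℚ))` of the bed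
(realising ideles) is at most the displayed place sum, `T(n) = n(n+1)/2` (§1 packet by packet; `sum_finsum_comm`). With `a = J`, `b = 0` (harmonic, B24) and
`M = (S(l⋇)/l⋇)·Σᶠ h` (p482743): kept share `≤ f³ + (3/2)f·(1+o(1))` per place, `f = J/l⋇` — «cubic → linear, never → 1». [claim: Mochizuki2012, status: disputed] -/
theorem keptMass_settingPrVolSharp_le_of_linearCredit
    (ω : Fin (thetaIndex X).lstar × (thetaIndex X).VQ → ℝ) (hω1 : ∀ c, ω c ≤ 1)
    {J : (thetaIndex X).VQ → ℕ} (hJ : ∀ vQ, J vQ ≤ X.lstar) {a b : (thetaIndex X).VQ → ℝ} (ha : ∀ vQ, 0 ≤ a vQ) (hb : ∀ vQ, 0 ≤ b vQ)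
    (hlin : ∀ (i : Fin (thetaIndex X).lstar) (vQ : (thetaIndex X).VQ), J vQ < (i : ℕ) + 1 →
      ω (i, vQ) * ((((i : ℕ) : ℝ) + 1) ^ 2 - 1) ≤ a vQ * (((i : ℕ) : ℝ) + 1) + b vQ) :
    processionNormalized (fun i : Fin (thetaIndex X).lstar => ∑ᶠ vQ : (thetaIndex X).VQ,
        ω (i, vQ) * cellTrivialCost (settingPrVolSharp X hlog M archPk archSub Ψ act Mmod region n lat sig split qData tq t htq0 htq1) (i, vQ)) ≤
      (∑ᶠ vQ : (thetaIndex X).VQ,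
        ((J vQ : ℝ) * (J vQ - 1) * (2 * J vQ + 5) / 6 + a vQ * ((X.lstar : ℝ) * (X.lstar + 1) / 2) + b vQ * X.lstar) *
          Sum.elim (fun _ : Unit => (0 : ℝ))
            (fun pp : Nat.Primes => (∑ v ∈ placesOver F pp, X.qPilot v * logNorm F v) / Module.finrank ℚ F) vQ) / X.lstar := by
  have hcost := cellTrivialCost_settingPrVolSharp_eq_sqSubOne_mul_placeWeight X hlog M archPk archSub Ψ act Mmod region n lat sig split qData tq t
    htq0 htq1 ht0 ht htq
  have hhfin := placeWeight_support_finite X hlog M archPk archSub Ψ act Mmod region n lat sig split qData tq t htq0 htq1 htq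
  -- per-label finite support of the kept summands (inside the support of `h`)
  have hsupp : ∀ i : Fin (thetaIndex X).lstar, (Function.support fun vQ : (thetaIndex X).VQ =>
      ω (i, vQ) * cellTrivialCost (settingPrVolSharp X hlog M archPk archSub Ψ act Mmod region n lat sig split qData tq t htq0 htq1) (i, vQ)).Finite :=
    fun i => hhfin.subset (Function.support_subset_iff'.2 fun vQ hvQ => by
      rw [hcost i vQ, Function.notMem_support.1 hvQ, mul_zero, mul_zero])
  unfold processionNormalized
  rw [sum_finsum_comm Finset.univ (fun (i : Fin (thetaIndex X).lstar) (vQ : (thetaIndex X).VQ) =>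
      ω (i, vQ) * cellTrivialCost (settingPrVolSharp X hlog M archPk archSub Ψ act Mmod region n lat sig split qData tq t htq0 htq1) (i, vQ))
    fun i _ => hsupp i]
  refine div_le_div_of_nonneg_right ?_ (Nat.cast_nonneg _)
  have hF : (Function.support fun vQ : (thetaIndex X).VQ => ∑ i : Fin (thetaIndex X).lstar,
      ω (i, vQ) * cellTrivialCost (settingPrVolSharp X hlog M archPk archSub Ψ act Mmod region n lat sig split qData tq t htq0 htq1) (i, vQ)).Finite :=
    hhfin.subset (Function.support_subset_iff'.2 fun vQ hvQ => Finset.sum_eq_zero fun i _ => by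
      rw [hcost i vQ, Function.notMem_support.1 hvQ, mul_zero, mul_zero])
  have hG : (Function.support fun vQ : (thetaIndex X).VQ =>
      ((J vQ : ℝ) * (J vQ - 1) * (2 * J vQ + 5) / 6 + a vQ * ((X.lstar : ℝ) * (X.lstar + 1) / 2) + b vQ * X.lstar) *
        Sum.elim (fun _ : Unit => (0 : ℝ))
          (fun pp : Nat.Primes => (∑ v ∈ placesOver F pp, X.qPilot v * logNorm F v) / Module.finrank ℚ F) vQ).Finite :=
    hhfin.subset (Function.support_subset_iff'.2 fun vQ hvQ => by rw [Function.notMem_support.1 hvQ, mul_zero])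
  refine finsum_le_finsum' hF hG fun vQ => ?_
  simp only [hcost]
  exact placeSum_credit_le_of_linear (hJ vQ) (fun i => ω (i, vQ)) (fun i => hω1 _) (ha vQ) (hb vQ) (placeWeight_nonneg X vQ)
    (fun i hi => hlin i vQ hi)

include ht0 ht htq in
/-- **(S1-b) AT THE BED: a `θ·j²` credit keeps `K(ω) ≤ (1/l⋇)·Σᶠ_{v_ℚ} (S(J(v_ℚ)) + θ(v_ℚ)·(S(l⋇) − S(J(v_ℚ))))·h(v_ℚ)`** — a candidate certifying above the
slice the fraction `θ(v_ℚ)` of each cell's `(j²−1)`-demand, `ω(i,v_ℚ)·((i+1)²−1) ≤ θ(v_ℚ)·((i+1)²−1)` for `i+1 > J(v_ℚ)`, keeps at most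
`S(J) + θ·(S(l⋇) − S(J))` of the place's `S(l⋇)` (READING: exponent `≈ 1/(f³ + θ(1−f³))`; `θ = 1` is the licence, door N12). [claim: Mochizuki2012, status: disputed] -/
theorem keptMass_settingPrVolSharp_le_of_quadraticCredit
    (ω : Fin (thetaIndex X).lstar × (thetaIndex X).VQ → ℝ) (hω1 : ∀ c, ω c ≤ 1)
    {J : (thetaIndex X).VQ → ℕ} (hJ : ∀ vQ, J vQ ≤ X.lstar) {θ : (thetaIndex X).VQ → ℝ}
    (hquad : ∀ (i : Fin (thetaIndex X).lstar) (vQ : (thetaIndex X).VQ), J vQ < (i : ℕ) + 1 →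
      ω (i, vQ) * ((((i : ℕ) : ℝ) + 1) ^ 2 - 1) ≤ θ vQ * ((((i : ℕ) : ℝ) + 1) ^ 2 - 1)) :
    processionNormalized (fun i : Fin (thetaIndex X).lstar => ∑ᶠ vQ : (thetaIndex X).VQ,
        ω (i, vQ) * cellTrivialCost (settingPrVolSharp X hlog M archPk archSub Ψ act Mmod region n lat sig split qData tq t htq0 htq1) (i, vQ)) ≤
      (∑ᶠ vQ : (thetaIndex X).VQ,
        ((J vQ : ℝ) * (J vQ - 1) * (2 * J vQ + 5) / 6 +
            θ vQ * ((X.lstar : ℝ) * (X.lstar - 1) * (2 * X.lstar + 5) / 6 - (J vQ : ℝ) * (J vQ - 1) * (2 * J vQ + 5) / 6)) *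
          Sum.elim (fun _ : Unit => (0 : ℝ))
            (fun pp : Nat.Primes => (∑ v ∈ placesOver F pp, X.qPilot v * logNorm F v) / Module.finrank ℚ F) vQ) / X.lstar := by
  have hcost := cellTrivialCost_settingPrVolSharp_eq_sqSubOne_mul_placeWeight X hlog M archPk archSub Ψ act Mmod region n lat sig split qData tq t
    htq0 htq1 ht0 ht htq
  have hhfin := placeWeight_support_finite X hlog M archPk archSub Ψ act Mmod region n lat sig split qData tq t htq0 htq1 htq
  have hsupp : ∀ i : Fin (thetaIndex X).lstar, (Function.support fun vQ : (thetaIndex X).VQ =>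
      ω (i, vQ) * cellTrivialCost (settingPrVolSharp X hlog M archPk archSub Ψ act Mmod region n lat sig split qData tq t htq0 htq1) (i, vQ)).Finite :=
    fun i => hhfin.subset (Function.support_subset_iff'.2 fun vQ hvQ => by
      rw [hcost i vQ, Function.notMem_support.1 hvQ, mul_zero, mul_zero])
  unfold processionNormalized
  rw [sum_finsum_comm Finset.univ (fun (i : Fin (thetaIndex X).lstar) (vQ : (thetaIndex X).VQ) =>
      ω (i, vQ) * cellTrivialCost (settingPrVolSharp X hlog M archPk archSub Ψ act Mmod region n lat sig split qData tq t htq0 htq1) (i, vQ))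
    fun i _ => hsupp i]
  refine div_le_div_of_nonneg_right ?_ (Nat.cast_nonneg _)
  have hF : (Function.support fun vQ : (thetaIndex X).VQ => ∑ i : Fin (thetaIndex X).lstar,
      ω (i, vQ) * cellTrivialCost (settingPrVolSharp X hlog M archPk archSub Ψ act Mmod region n lat sig split qData tq t htq0 htq1) (i, vQ)).Finite :=
    hhfin.subset (Function.support_subset_iff'.2 fun vQ hvQ => Finset.sum_eq_zero fun i _ => by
      rw [hcost i vQ, Function.notMem_support.1 hvQ, mul_zero, mul_zero])
  have hG : (Function.support fun vQ : (thetaIndex X).VQ =>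
      ((J vQ : ℝ) * (J vQ - 1) * (2 * J vQ + 5) / 6 +
          θ vQ * ((X.lstar : ℝ) * (X.lstar - 1) * (2 * X.lstar + 5) / 6 - (J vQ : ℝ) * (J vQ - 1) * (2 * J vQ + 5) / 6)) *
        Sum.elim (fun _ : Unit => (0 : ℝ))
          (fun pp : Nat.Primes => (∑ v ∈ placesOver F pp, X.qPilot v * logNorm F v) / Module.finrank ℚ F) vQ).Finite :=
    hhfin.subset (Function.support_subset_iff'.2 fun vQ hvQ => by rw [Function.notMem_support.1 hvQ, mul_zero])
  refine finsum_le_finsum' hF hG fun vQ => ?_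
  simp only [hcost]
  exact placeSum_credit_le_of_quadratic (hJ vQ) (fun i => ω (i, vQ)) (fun i => hω1 _) (placeWeight_nonneg X vQ) (fun i hi => hquad i vQ hi)

include ht0 ht htq in
/-- **(S1-a) UNIFORM FORM: `K(ω) ≤ ((S(J) + a·T(l⋇) + b·l⋇)/S(l⋇))·M`.** With the SAME slice boundary `J` and credit coefficients `a, b ≥ 0` at every packet, the
ω-kept mass is at most the displayed FRACTION of the total trivial mass `M` (= `T.gap` at a genuine datum, p478601) — `M = (S(l⋇)/l⋇)·Σᶠ h` (p482743
`totalTrivialMass_settingPrVolSharp_eq_sqSubOneSum_mul_finsum_placeWeight`). For the harmonic profile (`a = J`, `b = 0`) the fraction is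
`S(J)/S(l⋇) + 3J(l⋇+1)/((l⋇−1)(2l⋇+5))` (`harmonicKeptFrac_eq`) `→ f³ + (3/2)·f`: so [MU-C] for such a candidate needs `μ₀ ≲ f³ + 1.5f`, i.e. exponent
`≳ 1/(1.5 f)` at small `f` — SCREEN RULE S1 (a) as a theorem about EVERY `O(j)` credit. [claim: Mochizuki2012, status: disputed] -/
theorem keptMass_settingPrVolSharp_le_frac_mul_totalTrivialMass
    (ω : Fin (thetaIndex X).lstar × (thetaIndex X).VQ → ℝ) (hω1 : ∀ c, ω c ≤ 1)
    {J : ℕ} (hJ : J ≤ X.lstar) {a b : ℝ} (ha : 0 ≤ a) (hb : 0 ≤ b)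
    (hlin : ∀ (i : Fin (thetaIndex X).lstar) (vQ : (thetaIndex X).VQ), J < (i : ℕ) + 1 →
      ω (i, vQ) * ((((i : ℕ) : ℝ) + 1) ^ 2 - 1) ≤ a * (((i : ℕ) : ℝ) + 1) + b) :
    processionNormalized (fun i : Fin (thetaIndex X).lstar => ∑ᶠ vQ : (thetaIndex X).VQ,
        ω (i, vQ) * cellTrivialCost (settingPrVolSharp X hlog M archPk archSub Ψ act Mmod region n lat sig split qData tq t htq0 htq1) (i, vQ)) ≤
      ((J : ℝ) * (J - 1) * (2 * J + 5) / 6 + a * ((X.lstar : ℝ) * (X.lstar + 1) / 2) + b * X.lstar) /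
          ((X.lstar : ℝ) * (X.lstar - 1) * (2 * X.lstar + 5) / 6) *
        totalTrivialMass (settingPrVolSharp X hlog M archPk archSub Ψ act Mmod region n lat sig split qData tq t htq0 htq1) := by
  have h := keptMass_settingPrVolSharp_le_of_linearCredit X hlog M archPk archSub Ψ act Mmod region n lat sig split qData tq t htq0 htq1 ht0 ht htq
    ω hω1 (J := fun _ => J) (fun _ => hJ) (a := fun _ => a) (b := fun _ => b) (fun _ => ha) (fun _ => hb) (fun i vQ hi => hlin i vQ hi)
  rw [totalTrivialMass_settingPrVolSharp_eq_sqSubOneSum_mul_finsum_placeWeight X hlog M archPk archSub Ψ act Mmod region n lat sig split qData tq t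
    htq0 htq1 ht0 ht htq]
  rw [← mul_finsum] at h
  have hSpos : (0 : ℝ) < (X.lstar : ℝ) * (X.lstar - 1) * (2 * X.lstar + 5) / 6 := sqSubOneSum_pos X.two_le_lstar
  have h2 : (2 : ℝ) ≤ X.lstar := by exact_mod_cast X.two_le_lstar
  have hl0 : (X.lstar : ℝ) ≠ 0 := by positivity
  have hl1 : (X.lstar : ℝ) - 1 ≠ 0 := (show (0 : ℝ) < X.lstar - 1 by linarith).ne'
  have hl5 : 2 * (X.lstar : ℝ) + 5 ≠ 0 := by positivity
  refine h.trans (le_of_eq ?_)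
  field_simp

end Bed

end Summit.ABC.IUTFork.Repair.RH.CellWeights

end
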